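import Literature.MathematicalPhysics.QuantumFieldTheory.BalabanImbrieJaffe1984to88.BIJ88EndChainFluct309

/-!
# `BalabanImbrieJaffe1984to88.BIJ88EndPolyFluct309` — T. Bałaban, J. Imbrie, A. Jaffe, *Effective action and cluster properties of the abelian
Higgs model*, Commun. Math. Phys. **114** (1988) 257–315 [BalabanImbrieJaffe1988], Sect. 5.13 p. 305–307 [PDF 49–51] with Sect. 5.14 (5.14.4)
p. 309 [PDF 53] and [Balaban1982Higgs2] (2.28)–(2.29) p. 563: **THE FAR-CUBE FLUCTUATION BOUND ON END-DECORATED POLYMERS OF ANY SIZE** — the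
three-cube chain of `BIJ88EndChainFluct309` generalized to a polymer `X″` of ANY number of cubes: the decorated cube `□_a ∈ X″`, a FAR cube
`□_n ∈ X″` not coupled to `□_a`, interpolation parameters `s ∈ [0,1]^I` supported in `X″`, conditioning on `Λ` = the sites off `□_a`.  From the
pointwise decay letter (b) for the restricted inverse, the geometry letters W (sites per cube) and R (off-diagonal row sums of `Δ`), and the
polymer's one geometric fact (the sites of `□_n` and the sites of `X″` coupled to `□_n` lie `≥ 1` cube side from the sites of `X″` coupled to
`□_a`):

  `Σ_k |T_{xk}| ≤ |X″|·W·c₁δ·R`  for `x ∈ □_n` or `x` a site of an `X″`-cube coupled to `□_n`      (`rowSum_boundary_le_poly`),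
  `⟨|D_n∘cm − D_n(cm₀)|⟩_s ≤ W·R·(|X″|Wc₁δR)²/m`  (sourceless class `ℱ = 0`)      (`fluct_le_poly`),

so that, with the far-cube engine `BIJ88ActInFarCube309.abs_actIn_le_of_condMean_fluct` (`|g₃(H,X″)| ≤ 2^{|X″|−1}·2K₀·M`), (5.14.4) located on an
end-decorated polymer of any size follows from clause (ii) for the decorated cube's neighbours and ONE decay factor `δ²` for the rest — print's
bookkeeping (p. 307: the factors `e^{−cr(e_k)}`, smaller than every power of `e_k`, *"control the sum over walks and partitions, and the
factorials"*): the instance file for `|X″| > 3` is the successor's (HOME/lit-balaban-p36/SUCCESSOR-g20.md), this file is its fluctuation input.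

statement-level skeleton of published theorems with citation tags; proofs where landed; nothing here is a claim about the Yang–Mills mass gap

PDF held: `paper:balaban1988-cmp114-bij-abelian-higgs-effective-action` (journal page = PDF page + 256); p. 307 (p0051) as quoted in `BIJ88EndChainFluct309`.

WHAT IS PROVED (unit `lit-balaban-p36`, generation 19 of the Phase-2 proof seat p36; SKELETON rows C2.Eq5.14.3-5.14.4 / C2.Eq5.13.3-5.13.4 of
`HOME/lit-balaban-r16/ROWS-C2-part2.md`, owner r16; 0 definitions, 0 `Prop` facts, theorems only).
* `card_filter_blk_mem_le` (at most `|X″|·W` sites in the cubes of `X″`), **`rowSum_boundary_le_poly`**, **`fluct_le_poly`** (reusing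
  `BIJ88EndChainFluct309.majorant_le_of_rows` and `sum_sum_abs_le`).
HONEST SCOPE: sourceless class; the geometry clause is a hypothesis (it holds for collinear chains of cubes of side `r(e_k)` with nearest-neighbour
coupling and fails e.g. for L-shaped triples, where a site of the middle cube can touch both `□_a` and `□_n`).  Imports `BIJ88EndChainFluct309`
(p36 g19); modifies nothing.  NOT summit progress; NOT continuum; NOT Clay.  Cell `lit-balaban` Phase 2, seat p36 gen 19 (owner r16, referee ref-5).
-/

noncomputable section

open Finset MeasureTheory Matrix Function Filter
open Literature.MathematicalPhysics.QuantumFieldTheory.Balaban1983to89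
open Literature.MathematicalPhysics.QuantumFieldTheory.BalabanImbrieJaffe1984to88
open B2Eq228Conditioning (In Out resIn resOut glue blkIn blkMix condShift)
open BIJ88DirichletForms305 (interpForm interpForm_apply interpForm_posDef quadForm_interpForm_ge)
open BIJ88PolymerRep5134 (corner)
open BIJ88PolymerRep5134GaussWitness (corner_mem_cube)
open BIJ88SecondOrder5133 (num Dfun)
open BIJ88ExpectTilt305 (inv_apply_self_le)
open BIJ88DexpCondMeanMajorant305 (expect_abs_Dfun_cm_sub_le)
open BIJ88EndChainFluct309 (abs_interpForm_apply_le interpForm_apply_eq_zero majorant_le_of_rows sum_sum_abs_le)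

namespace Literature.MathematicalPhysics.QuantumFieldTheory.BalabanImbrieJaffe1984to88.BIJ88EndPolyFluct309

variable {α I : Type} [Fintype α] [DecidableEq α] [Fintype I] [DecidableEq I] (blk : α → I) {Δ : Matrix α α ℝ}

/-! ## §1 Rows of the boundary operator on an end-decorated polymer -/

omit [Fintype I] in
/-- at most `|X″|·W` sites of `Λ` lie in the cubes of `X″`. [cite: BalabanImbrieJaffe1988, §5.13 p.305] -/
theorem card_filter_blk_mem_le (P : α → Prop) [DecidablePred P] (X'' : Finset I) {W : ℕ}
    (hW : ∀ i, (univ.filter fun x : α => blk x = i).card ≤ W) :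
    ((univ : Finset (In P)).filter fun l => blk l.1 ∈ X'').card ≤ X''.card * W := by
  have h1 : ((univ : Finset (In P)).filter fun l => blk l.1 ∈ X'').card ≤ (univ.filter fun y : α => blk y ∈ X'').card :=
    card_le_card_of_injOn (fun l => l.1)
      (fun l hl => by
        simp only [coe_filter, mem_univ, true_and, Set.mem_setOf_eq] at hl ⊢
        exact hl)
      (fun l₁ _ l₂ _ h => Subtype.ext h)
  have hsub : (univ.filter fun y : α => blk y ∈ X'') ⊆ X''.biUnion (fun i => univ.filter fun y : α => blk y = i) := by
    intro y hy
    rw [mem_biUnion]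
    exact ⟨blk y, (mem_filter.1 hy).2, mem_filter.2 ⟨mem_univ _, rfl⟩⟩
  calc _ ≤ (univ.filter fun y : α => blk y ∈ X'').card := h1
    _ ≤ (X''.biUnion (fun i => univ.filter fun y : α => blk y = i)).card := card_le_card hsub
    _ ≤ ∑ i ∈ X'', (univ.filter fun y : α => blk y = i).card := card_biUnion_le
    _ ≤ ∑ _i ∈ X'', W := sum_le_sum fun i _ => hW i
    _ = X''.card * W := by rw [sum_const, smul_eq_mul]

/-- **`Σ_k |T_{xk}| ≤ |X″|·W·c₁δ·R` on an end-decorated polymer** for `T = A_Λ⁻¹A_{ΛΛᶜ}`, `A = (Δ_{1_{Λ′}})_s`, `Λ = {x | □x ≠ a}`, `s ∈ [0,1]^I`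
supported in `X″`, and `x ∈ □_n` or `x` a site of an `X″`-cube coupled to `□_n`: only the sites `l` of `X″`-cubes coupled to `□_a` carry a nonzero
row of `A_{ΛΛᶜ}`, each such row sums to `≤ R`, there are `≤ |X″|·W` of them, and for them the decay letter gives `|(A_Λ)⁻¹(x,l)| ≤ c₁δ^{d(x,l)} ≤ c₁δ`
(`d(x,l) ≥ 1`: the polymer's geometry). [cite: BalabanImbrieJaffe1988, §5.13 p.307; (5.14.4) p.309] -/
theorem rowSum_boundary_le_poly {a n : I} (X'' : Finset I)
    {W : ℕ} (hW : ∀ i, (univ.filter fun x : α => blk x = i).card ≤ W)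
    {R : ℝ} (hR0 : 0 ≤ R) (hR : ∀ x, ∑ y ∈ univ.filter (fun y => blk y ≠ blk x), |Δ x y| ≤ R)
    (ds : α → α → ℕ) {c₁ δ : ℝ} (hc₁ : 0 ≤ c₁) (hδ0 : 0 ≤ δ) (hδ1 : δ ≤ 1)
    (hgeo : ∀ x l, (blk x = n ∨ (blk x ∈ X'' ∧ ∃ y, blk y = n ∧ Δ y x ≠ 0)) → (blk l ∈ X'' ∧ ∃ k, blk k = a ∧ Δ l k ≠ 0) → 1 ≤ ds x l)
    (Λc : Finset I) {s : I → ℝ} (hs : ∀ l, 0 ≤ s l ∧ s l ≤ 1) (hs0 : ∀ l, l ∉ X'' → s l = 0)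
    (hdec : ∀ x l : In (fun x => blk x ≠ a),
      |(blkIn (fun x => blk x ≠ a) (interpForm blk (interpForm blk Δ (corner ℝ Λc)) s))⁻¹ x l| ≤ c₁ * δ ^ ds x.1 l.1)
    (x : In (fun x => blk x ≠ a)) (hx : blk x.1 = n ∨ (blk x.1 ∈ X'' ∧ ∃ y, blk y = n ∧ Δ y x.1 ≠ 0)) :
    ∑ k : Out (fun x => blk x ≠ a), |((blkIn (fun x => blk x ≠ a) (interpForm blk (interpForm blk Δ (corner ℝ Λc)) s))⁻¹ *
        blkMix (fun x => blk x ≠ a) (interpForm blk (interpForm blk Δ (corner ℝ Λc)) s)) x k| ≤ (X''.card * W) * (c₁ * δ * R) := by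
  have hk : ∀ k : Out (fun x => blk x ≠ a), blk k.1 = a := fun k => not_ne_iff.1 k.2
  have hcs := corner_mem_cube (I := I) Λc
  -- the entries of `A_{ΛΛᶜ}`: `A(l,k) = s_{□l} s_a (Δ_{1_{Λ′}})_{lk}`
  have hAlk : ∀ (l : In (fun x => blk x ≠ a)) (k : Out (fun x => blk x ≠ a)),
      interpForm blk (interpForm blk Δ (corner ℝ Λc)) s l.1 k.1 = s (blk l.1) * s a * interpForm blk Δ (corner ℝ Λc) l.1 k.1 := by
    intro l k
    rw [interpForm_apply, if_neg (by rw [hk k]; exact l.2), hk k]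
  have hAabs : ∀ (l : In (fun x => blk x ≠ a)) (k : Out (fun x => blk x ≠ a)),
      |interpForm blk (interpForm blk Δ (corner ℝ Λc)) s l.1 k.1| ≤ |Δ l.1 k.1| := fun l k => by
    rw [hAlk, abs_mul, abs_mul, abs_of_nonneg (hs _).1, abs_of_nonneg (hs _).1]
    exact (mul_le_of_le_one_left (abs_nonneg _) (mul_le_one₀ (hs _).2 (hs _).1 (hs _).2)).trans
      (abs_interpForm_apply_le blk Δ hcs _ _)
  -- every row of `A_{ΛΛᶜ}` sums to `≤ R`
  have hrowR : ∀ l : In (fun x => blk x ≠ a),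
      ∑ k : Out (fun x => blk x ≠ a), |interpForm blk (interpForm blk Δ (corner ℝ Λc)) s l.1 k.1| ≤ R := by
    intro l
    have hmap : (univ : Finset (Out (fun x => blk x ≠ a))).map (Embedding.subtype _) ⊆ univ.filter (fun y => blk y ≠ blk l.1) := by
      intro y hy
      rw [Finset.mem_map] at hy
      obtain ⟨k, -, rfl⟩ := hy
      refine mem_filter.2 ⟨mem_univ _, ?_⟩
      rw [Embedding.coe_subtype, hk k]
      exact fun h => l.2 h.symm
    calc ∑ k : Out (fun x => blk x ≠ a), |interpForm blk (interpForm blk Δ (corner ℝ Λc)) s l.1 k.1|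
        ≤ ∑ k : Out (fun x => blk x ≠ a), |Δ l.1 k.1| := sum_le_sum fun k _ => hAabs l k
      _ = ∑ y ∈ (univ : Finset (Out (fun x => blk x ≠ a))).map (Embedding.subtype _), |Δ l.1 y| := by rw [sum_map]; rfl
      _ ≤ ∑ y ∈ univ.filter (fun y => blk y ≠ blk l.1), |Δ l.1 y| := sum_le_sum_of_subset_of_nonneg hmap fun _ _ _ => abs_nonneg _
      _ ≤ R := hR l.1
  -- and vanishes unless `l` lies in an `X″`-cube and is coupled to `□_a`
  have hrow0 : ∀ l : In (fun x => blk x ≠ a), ¬ (blk l.1 ∈ X'' ∧ ∃ k, blk k = a ∧ Δ l.1 k ≠ 0) →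
      ∑ k : Out (fun x => blk x ≠ a), |interpForm blk (interpForm blk Δ (corner ℝ Λc)) s l.1 k.1| = 0 := by
    intro l hl
    refine sum_eq_zero fun k _ => ?_
    rw [abs_eq_zero, hAlk]
    by_cases hlX : blk l.1 ∈ X''
    · have h0 : Δ l.1 k.1 = 0 := by
        by_contra h
        exact hl ⟨hlX, k.1, hk k, h⟩
      rw [interpForm_apply_eq_zero blk Δ _ h0, mul_zero]
    · rw [hs0 _ hlX, zero_mul, zero_mul]
  -- each `l` contributes `≤ c₁δR` if `□l ∈ X″`, else nothing
  have hl : ∀ l : In (fun x => blk x ≠ a),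
      |(blkIn (fun x => blk x ≠ a) (interpForm blk (interpForm blk Δ (corner ℝ Λc)) s))⁻¹ x l| *
          ∑ k : Out (fun x => blk x ≠ a), |interpForm blk (interpForm blk Δ (corner ℝ Λc)) s l.1 k.1|
        ≤ if blk l.1 ∈ X'' then c₁ * δ * R else 0 := by
    intro l
    by_cases hcpl : blk l.1 ∈ X'' ∧ ∃ k, blk k = a ∧ Δ l.1 k ≠ 0
    · rw [if_pos hcpl.1]
      have h1 : |(blkIn (fun x => blk x ≠ a) (interpForm blk (interpForm blk Δ (corner ℝ Λc)) s))⁻¹ x l| ≤ c₁ * δ := by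
        refine (hdec x l).trans (mul_le_mul_of_nonneg_left ?_ hc₁)
        calc δ ^ ds x.1 l.1 ≤ δ ^ 1 := pow_le_pow_of_le_one hδ0 hδ1 (hgeo x.1 l.1 hx hcpl)
          _ = δ := pow_one δ
      calc _ ≤ (c₁ * δ) * R := mul_le_mul h1 (hrowR l) (sum_nonneg fun _ _ => abs_nonneg _) (mul_nonneg hc₁ hδ0)
        _ = c₁ * δ * R := by ring
    · rw [hrow0 l hcpl, mul_zero]
      split_ifs
      · exact mul_nonneg (mul_nonneg hc₁ hδ0) hR0
      · exact le_rfl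
  have hcardW : (((univ : Finset (In (fun x => blk x ≠ a))).filter fun l => blk l.1 ∈ X'').card : ℝ) ≤ X''.card * W := by
    exact_mod_cast card_filter_blk_mem_le blk (fun x => blk x ≠ a) X'' hW
  calc ∑ k : Out (fun x => blk x ≠ a), |((blkIn (fun x => blk x ≠ a) (interpForm blk (interpForm blk Δ (corner ℝ Λc)) s))⁻¹ *
          blkMix (fun x => blk x ≠ a) (interpForm blk (interpForm blk Δ (corner ℝ Λc)) s)) x k|
      = ∑ k : Out (fun x => blk x ≠ a), |∑ l, (blkIn (fun x => blk x ≠ a) (interpForm blk (interpForm blk Δ (corner ℝ Λc)) s))⁻¹ x l *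
          interpForm blk (interpForm blk Δ (corner ℝ Λc)) s l.1 k.1| := by
        simp only [Matrix.mul_apply, blkMix, Matrix.submatrix_apply]
    _ ≤ ∑ k : Out (fun x => blk x ≠ a), ∑ l, |(blkIn (fun x => blk x ≠ a) (interpForm blk (interpForm blk Δ (corner ℝ Λc)) s))⁻¹ x l| *
          |interpForm blk (interpForm blk Δ (corner ℝ Λc)) s l.1 k.1| :=
        sum_le_sum fun k _ => (abs_sum_le_sum_abs _ _).trans (le_of_eq (sum_congr rfl fun l _ => abs_mul _ _))
    _ = ∑ l, |(blkIn (fun x => blk x ≠ a) (interpForm blk (interpForm blk Δ (corner ℝ Λc)) s))⁻¹ x l| *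
          ∑ k : Out (fun x => blk x ≠ a), |interpForm blk (interpForm blk Δ (corner ℝ Λc)) s l.1 k.1| := by
        rw [sum_comm]; simp only [mul_sum]
    _ ≤ ∑ l : In (fun x => blk x ≠ a), (if blk l.1 ∈ X'' then c₁ * δ * R else 0) := sum_le_sum fun l _ => hl l
    _ = (((univ : Finset (In (fun x => blk x ≠ a))).filter fun l => blk l.1 ∈ X'').card : ℝ) * (c₁ * δ * R) := by
        rw [← sum_filter, sum_const, nsmul_eq_mul]
    _ ≤ (X''.card * W) * (c₁ * δ * R) := mul_le_mul_of_nonneg_right hcardW (mul_nonneg (mul_nonneg hc₁ hδ0) hR0)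

/-! ## §2 The fluctuation of the far cube's pulled-down factor on an end-decorated polymer -/

/-- **`⟨|D_n∘cm − D_n(cm₀)|⟩_s ≤ W·R·(|X″|Wc₁δR)²/m` on a sourceless end-decorated polymer** (`ℱ = 0`; `Δ ≻ 0`, `Δ ≥ m·1`; `□_n ∈ X″` not
coupled to `□_a`; W, R; the decay letter (b) at `s`; `s ∈ [0,1]^I` supported in `X″`): the majorant `expect_abs_Dfun_cm_sub_le` with vanishing
drifts, `(Δ_s⁻¹)_{kk} ≤ 1/m`, the pairs `x ∈ □_n`, `y` a site of an `X″`-cube coupled to `□_n` (`≤ W·R` in `|Δ_{xy}|`-weight) and both rows of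
`T` bounded by §1. [cite: BalabanImbrieJaffe1988, §5.13 p.307; (5.14.4) p.309] -/
theorem fluct_le_poly (hΔ : Δ.PosDef) {m : ℝ} (hm : 0 < m) (hΔm : ∀ φ : α → ℝ, m * (φ ⬝ᵥ φ) ≤ φ ⬝ᵥ (Δ *ᵥ φ))
    {a n : I} (han : a ≠ n) (X'' : Finset I) (hfar : ∀ x y, blk x = n → blk y = a → Δ x y = 0)
    {W : ℕ} (hW : ∀ i, (univ.filter fun x : α => blk x = i).card ≤ W)
    {R : ℝ} (hR0 : 0 ≤ R) (hR : ∀ x, ∑ y ∈ univ.filter (fun y => blk y ≠ blk x), |Δ x y| ≤ R)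
    (ds : α → α → ℕ) {c₁ δ : ℝ} (hc₁ : 0 ≤ c₁) (hδ0 : 0 ≤ δ) (hδ1 : δ ≤ 1)
    (hgeo : ∀ x l, (blk x = n ∨ (blk x ∈ X'' ∧ ∃ y, blk y = n ∧ Δ y x ≠ 0)) → (blk l ∈ X'' ∧ ∃ k, blk k = a ∧ Δ l k ≠ 0) → 1 ≤ ds x l)
    (Λc : Finset I) {s : I → ℝ} (hs : ∀ l, 0 ≤ s l ∧ s l ≤ 1) (hs0 : ∀ l, l ∉ X'' → s l = 0)
    (hdec : ∀ x l : In (fun x => blk x ≠ a),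
      |(blkIn (fun x => blk x ≠ a) (interpForm blk (interpForm blk Δ (corner ℝ Λc)) s))⁻¹ x l| ≤ c₁ * δ ^ ds x.1 l.1) :
    num blk (interpForm blk Δ (corner ℝ Λc)) 0 (fun φ => |Dfun blk (interpForm blk Δ (corner ℝ Λc)) s n
          (glue (fun x => blk x ≠ a) (condShift (fun x => blk x ≠ a) (interpForm blk (interpForm blk Δ (corner ℝ Λc)) s) 0
            (resOut (fun x => blk x ≠ a) φ)) (resOut (fun x => blk x ≠ a) φ))
        - Dfun blk (interpForm blk Δ (corner ℝ Λc)) s n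
          (glue (fun x => blk x ≠ a) ((blkIn (fun x => blk x ≠ a) (interpForm blk (interpForm blk Δ (corner ℝ Λc)) s))⁻¹ *ᵥ
            resIn (fun x => blk x ≠ a) 0) 0)|) s
        / num blk (interpForm blk Δ (corner ℝ Λc)) 0 (fun _ => 1) s
      ≤ W * R * (((X''.card * W) * (c₁ * δ * R)) ^ 2 * m⁻¹) := by
  have hcs := corner_mem_cube (I := I) Λc
  have hΔc : (interpForm blk Δ (corner ℝ Λc)).PosDef := interpForm_posDef blk hΔ hcs
  have hmΔc : ∀ φ : α → ℝ, m * (φ ⬝ᵥ φ) ≤ φ ⬝ᵥ (interpForm blk Δ (corner ℝ Λc) *ᵥ φ) := quadForm_interpForm_ge blk hΔm hcs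
  have hA : (interpForm blk (interpForm blk Δ (corner ℝ Λc)) s).PosDef := interpForm_posDef blk hΔc hs
  have hmA : ∀ v : α → ℝ, m * (v ⬝ᵥ v) ≤ v ⬝ᵥ (interpForm blk (interpForm blk Δ (corner ℝ Λc)) s *ᵥ v) :=
    quadForm_interpForm_ge blk hmΔc hs
  have hPn : ∀ x, blk x = n → (fun x => blk x ≠ a) x := fun x hx h => han (h.symm.trans hx)
  have hfar' : ∀ x y, blk x = n → ¬ (fun x => blk x ≠ a) y → interpForm blk Δ (corner ℝ Λc) x y = 0 :=
    fun x y hx hy => interpForm_apply_eq_zero blk Δ _ (hfar x y hx (not_ne_iff.1 hy))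
  have hmaj := expect_abs_Dfun_cm_sub_le blk hΔc (0 : α → ℝ) hs (fun x => blk x ≠ a) hPn hfar'
    (interpForm blk (interpForm blk Δ (corner ℝ Λc)) s) rfl
    ((blkIn (fun x => blk x ≠ a) (interpForm blk (interpForm blk Δ (corner ℝ Λc)) s))⁻¹ *
      blkMix (fun x => blk x ≠ a) (interpForm blk (interpForm blk Δ (corner ℝ Λc)) s)) rfl
    ((blkIn (fun x => blk x ≠ a) (interpForm blk (interpForm blk Δ (corner ℝ Λc)) s))⁻¹ *ᵥ resIn (fun x => blk x ≠ a) 0) rfl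
    ((interpForm blk (interpForm blk Δ (corner ℝ Λc)) s)⁻¹ *ᵥ 0) rfl
  refine hmaj.trans ?_
  have hd0 : (blkIn (fun x => blk x ≠ a) (interpForm blk (interpForm blk Δ (corner ℝ Λc)) s))⁻¹ *ᵥ
      resIn (fun x => blk x ≠ a) (0 : α → ℝ) = 0 := by
    rw [show resIn (fun x => blk x ≠ a) (0 : α → ℝ) = 0 from rfl, mulVec_zero]
  have hm' : ∀ k : Out (fun x => blk x ≠ a), (interpForm blk (interpForm blk Δ (corner ℝ Λc)) s)⁻¹ k.1 k.1 +
      ((interpForm blk (interpForm blk Δ (corner ℝ Λc)) s)⁻¹ *ᵥ (0 : α → ℝ)) k.1 ^ 2 ≤ m⁻¹ := fun k => by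
    rw [mulVec_zero, Pi.zero_apply, sq, mul_zero, add_zero]; exact inv_apply_self_le hA hm hmA k.1
  have hm0' : ∀ k : Out (fun x => blk x ≠ a), 0 ≤ (interpForm blk (interpForm blk Δ (corner ℝ Λc)) s)⁻¹ k.1 k.1 +
      ((interpForm blk (interpForm blk Δ (corner ℝ Λc)) s)⁻¹ *ᵥ (0 : α → ℝ)) k.1 ^ 2 := fun k =>
    add_nonneg hA.inv.posSemidef.diag_nonneg (sq_nonneg _)
  have hC : 0 ≤ ((X''.card * W) * (c₁ * δ * R)) ^ 2 * m⁻¹ := mul_nonneg (sq_nonneg _) (inv_nonneg.2 hm.le)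
  refine (majorant_le_of_rows blk (fun x => blk x ≠ a) s n (interpForm blk Δ (corner ℝ Λc)) _ _ _ _ hd0 (inv_nonneg.2 hm.le)
    hm' hm0' (fun j => blk j.1 ∈ X'' ∧ ∃ y, blk y = n ∧ Δ y j.1 ≠ 0)
    (fun x hx => rowSum_boundary_le_poly blk X'' hW hR0 hR ds hc₁ hδ0 hδ1 hgeo Λc hs hs0 hdec x hx)
    (fun i j => |Δ i.1 j.1|) (fun _ _ => abs_nonneg _) (fun i j _ _ => ?_) (fun i j hi hj hq => ?_)).trans ?_
  · rw [abs_mul, abs_of_nonneg (hs _).1]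
    exact (mul_le_of_le_one_left (abs_nonneg _) (hs _).2).trans (abs_interpForm_apply_le blk Δ hcs _ _)
  · push Not at hq
    by_cases hjX : blk j.1 ∈ X''
    · rw [interpForm_apply_eq_zero blk Δ _ (hq hjX _ hi), mul_zero]
    · rw [hs0 _ hjX, zero_mul]
  · have hsum := sum_sum_abs_le blk (fun x => blk x ≠ a) n hW hR0 hR
    calc ∑ i : In (fun x => blk x ≠ a), ∑ j : In (fun x => blk x ≠ a),
          (if blk i.1 = n ∧ blk j.1 ≠ n then |Δ i.1 j.1| else 0) * (((X''.card * W) * (c₁ * δ * R)) ^ 2 * m⁻¹)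
        = (∑ i : In (fun x => blk x ≠ a), ∑ j : In (fun x => blk x ≠ a),
            if blk i.1 = n ∧ blk j.1 ≠ n then |Δ i.1 j.1| else 0) * (((X''.card * W) * (c₁ * δ * R)) ^ 2 * m⁻¹) := by simp only [sum_mul]
      _ ≤ (W * R) * (((X''.card * W) * (c₁ * δ * R)) ^ 2 * m⁻¹) := mul_le_mul_of_nonneg_right hsum hC
      _ = W * R * (((X''.card * W) * (c₁ * δ * R)) ^ 2 * m⁻¹) := rfl

end Literature.MathematicalPhysics.QuantumFieldTheory.BalabanImbrieJaffe1984to88.BIJ88EndPolyFluct309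

end
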